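import Literature.NumberTheory.LFunctions.HeckeThetaContinuation
import HarnessLib

/-!
# The dual side of Hecke's weak FE-pair: coset decomposition of `Θ̂̃`, and its Mellin transform

Topic `Literature/NumberTheory/LFunctions`; namespace `Literature.NumberTheory.LFunctions.NumberField`
(continuing `HeckeThetaMellin.lean`, `HeckeThetaContinuation.lean`).  Analytic input of Hecke's
**functional equation** for the L-series of primitive ray class characters (Neukirch, *Algebraic Number
Theory*, VII (8.5)–(8.6), in the coset language of Remark 1 after (8.6)): the tree's weak FE-pair
`P = heckePairW K p 𝔞 a₀ N` (`k = 1/2`, `f = ∫_{[0,1]^{r-1}} Θ̃^p_{𝔞,a₀}(y(Nc,t)) dc`,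
`g = ∫ Θ̂̃^p_{(𝔞𝔡)⁻¹, a₀}(y(-Nc,t)) dc`) identifies `Λ_P(s/2)` with the signed coset Dirichlet series
(`heckePairW_Λ_eq_signedCosetSum`); Mathlib's Mellin principle gives `Λ_P(1/2 - s') = ε Λ_{P^symm}(s')`,
and for the functional equation one needs `Λ_{P^symm}(s/2)` — the Mellin transform of the **dual**
theta function `Θ̂̃^p_{𝔟,a₀}(y) = Σ_{b ∈ 𝔟} e^{2πi Tr(a₀ b)} N(b^p) N(y^{p/2}) e^{-π⟨by,b⟩}`,
`𝔟 = (𝔞𝔡)⁻¹`.  We PROVE: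

* `heckeThetaDualW_eq_sum` — **coset decomposition**: for a sub-lattice `𝔠 ≤ 𝔟` on which the
  character `e^{2πi Tr(a₀ ·)}` is trivial and representatives `c_i` of `𝔟/𝔠`,
  `Θ̂̃^p_{𝔟,a₀}(y) = Σ_i e^{2πi Tr(a₀ c_i)} Θ̃^p_{𝔠, c_i}(y)` (the dual series is a character
  combination of *untwisted* coset theta series — the step "first they served to break up the theta
  series" of Neukirch VII §7, (7.6), here on the dual side);
* `heckeGW_eq_sum` — the same for the cube integrals `g` and `f`;
* `heckeThetaW_heckeCoord_add_nsmul`, `heckeFW_neg_natCast` — for even `N` with `V = ⟨u_i^N⟩`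
  stabilising the coset, `c ↦ Θ̃(y(c,t))` is `Nℤ^{r-1}`-periodic and `f(-N) = f(N)` (reflection
  `c ↦ 1 - c` of the cube);
* `heckePairW_symm_Λ_eq_sum` — **the Mellin transform of the dual side**: for `re s > 1`,
  `Λ_{P^symm}(s/2) = Σ_i e^{2πi Tr(a₀ c_i)} Λ_{P_i}(s/2)` with `P_i = heckePairW K p 𝔠 c_i N`, hence
  (`heckePairW_symm_Λ_eq_sum_signedCosetSum`) `= c_N A_p(s/2) Σ_i e^{2πi Tr(a₀ c_i)} D_p[c_i + 𝔠](s)` by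
  the tree's unfolding of each `Λ_{P_i}`.

No definition, no named fact; theorems only.

## References

* J. Neukirch, *Algebraic Number Theory*, Grundlehren 322, Springer 1999, Ch. VII §3 (3.6), §7 (7.6)–(7.7),
  §8 (8.3)–(8.6) and Remark 1. [NeukirchANT1999]
* E. Hecke, *Eine neue Art von Zetafunktionen und ihre Beziehungen zur Verteilung der Primzahlen II*,
  Math. Z. 6 (1920), 11–51. [HeckeMathZ1920]
-/

noncomputable section

open MeasureTheory Filter Set Complex NumberField NumberField.InfinitePlace NumberField.Units
  NumberField.mixedEmbedding
open scoped Real Topology FourierTransform ENNReal NumberField nonZeroDivisors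

namespace Literature.NumberTheory.LFunctions

namespace NumberField

variable {K : Type*} [Field K] [NumberField K]

open scoped Classical

/-! ## The general term and its summability -/

/-- `‖N(x^p) N(y^{p/2}) e^{-π⟨xy,x⟩}‖ ≤ e^{-π⟨x(y/2),x⟩}` for `y ≥ 0`. [folklore] -/
theorem norm_heckeTerm_le (p : Finset {w : InfinitePlace K // IsReal w}) {y : InfinitePlace K → ℝ}
    (hy : ∀ w, 0 ≤ y w) (x : K) :
    ‖((realPow K p x * (∏ w ∈ p, Real.sqrt (y w.1)) * thetaSummand K y x : ℝ) : ℂ)‖ ≤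
      thetaSummand K (fun w ↦ y w / 2) x := by
  rw [Complex.norm_real, Real.norm_eq_abs, abs_realPow_mul_prod_sqrt_mul]
  exact weightedThetaSummand_le p hy x

/-- **The terms of `Θ̃^p_{𝔞,a₀}(y)` are absolutely summable** for `y > 0`. [folklore] -/
theorem summable_heckeTerm_add (p : Finset {w : InfinitePlace K // IsReal w}) (I : FractionalIdeal (𝓞 K)⁰ K)
    (a₀ : K) {y : InfinitePlace K → ℝ} (hy : ∀ w, 0 < y w) :
    Summable fun a : I ↦ ((realPow K p ((a : K) + a₀) * (∏ w ∈ p, Real.sqrt (y w.1)) *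
      thetaSummand K y ((a : K) + a₀) : ℝ) : ℂ) :=
  Summable.of_norm_bounded (summable_thetaSummand_add I a₀ fun w ↦ half_pos (hy w))
    fun _ ↦ norm_heckeTerm_le p (fun w ↦ (hy w).le) _

/-- The terms of the dual series are absolutely summable. [folklore] -/
theorem summable_heckeDualTerm (p : Finset {w : InfinitePlace K // IsReal w}) (I : FractionalIdeal (𝓞 K)⁰ K)
    (a₀ : K) {y : InfinitePlace K → ℝ} (hy : ∀ w, 0 < y w) :
    Summable fun b : I ↦ (𝐞 (((Algebra.trace ℚ K (a₀ * (b : K)) : ℚ) : ℝ)) : ℂ) *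
      ((realPow K p (b : K) * (∏ w ∈ p, Real.sqrt (y w.1)) * thetaSummand K y (b : K) : ℝ) : ℂ) := by
  have h := summable_thetaSummand_add I 0 fun w ↦ half_pos (hy w)
  simp only [add_zero] at h
  refine Summable.of_norm_bounded h fun b ↦ ?_
  rw [norm_mul, Circle.norm_coe, one_mul]
  exact norm_heckeTerm_le p (fun w ↦ (hy w).le) _

/-! ## Periodicity of `c ↦ Θ̃(y(c,t))` under the stabilising units `V = ⟨u_i^N⟩` -/

/-- The real embeddings of an even power of a unit are positive, so
`N(y(c + Nq, t)^{p/2}) = N(u_{Nq}^p) · N(y(c,t)^{p/2})` with the *signed* weight `N(u^p)`. [folklore] -/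
theorem prod_sqrt_heckeCoord_add_nsmul (p : Finset {w : InfinitePlace K // IsReal w}) {N : ℕ} (hN : Even N)
    (q : Fin (rank K) → ℤ) (c : Fin (rank K) → ℝ) (t : ℝ) :
    ∏ w ∈ p, Real.sqrt (heckeCoord K (c + fun i ↦ ((N • q) i : ℝ)) t w.1) =
      realPow K p (fundUnit K (N • q) : K) * ∏ w ∈ p, Real.sqrt (heckeCoord K c t w.1) := by
  rw [realPow, ← Finset.prod_mul_distrib]
  refine Finset.prod_congr rfl fun w _ ↦ ?_
  rw [heckeCoord_add_intCast, Real.sqrt_mul' _ (heckeCoord_pos c t w.1).le,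
    Real.sqrt_sq (apply_nonneg _ _), fundUnit]
  congr 1
  -- `w(u) = |τ_w(u)| = τ_w(u)` since `u` is a square
  rw [mixedEmbedding_apply_isReal]
  have hsq := fundUnit_nsmul_eq_sq (K := K) hN q
  rw [fundUnit] at hsq
  rw [hsq, map_pow, map_pow]
  have : (w.1 : InfinitePlace K) (fundUnit K ((N / 2) • q) : K) = |embedding_of_isReal w.2 (fundUnit K ((N / 2) • q) : K)| := by
    rw [← Real.norm_eq_abs, norm_embedding_of_isReal]
  rw [this, pow_two, pow_two, abs_mul_abs_self]

/-- The general term at `y(c + Nq, t)` and `x` is the general term at `y(c,t)` and `u_{Nq} x`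
(`N` even). [folklore] -/
theorem heckeTerm_heckeCoord_add_nsmul (p : Finset {w : InfinitePlace K // IsReal w}) {N : ℕ} (hN : Even N)
    (q : Fin (rank K) → ℤ) (c : Fin (rank K) → ℝ) (t : ℝ) (x : K) :
    ((realPow K p x * (∏ w ∈ p, Real.sqrt (heckeCoord K (c + fun i ↦ ((N • q) i : ℝ)) t w.1)) *
        thetaSummand K (heckeCoord K (c + fun i ↦ ((N • q) i : ℝ)) t) x : ℝ) : ℂ) =
      ((realPow K p ((fundUnit K (N • q) : K) * x) * (∏ w ∈ p, Real.sqrt (heckeCoord K c t w.1)) *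
        thetaSummand K (heckeCoord K c t) ((fundUnit K (N • q) : K) * x) : ℝ) : ℂ) := by
  rw [prod_sqrt_heckeCoord_add_nsmul p hN q c t, thetaSummand_fundUnit_mul, realPow_mul]
  push_cast
  ring

/-- **`Nℤ^{r-1}`-periodicity of `c ↦ Θ̃^p_{𝔞,a₀}(y(c,t))`**: for even `N` with `(u_i^N - 1) a₀ ∈ 𝔞`,
`Θ̃(y(c + Nq, t)) = Θ̃(y(c, t))` — the unit `u_{Nq}` permutes the coset `a₀ + 𝔞` and preserves the sign
weights (Neukirch VII (8.2): `χ_f(ε) N(ε^p) = 1` for units, here `N(ε^p) = 1` for even powers). [cite: NeukirchANT1999, Ch. VII §8 (8.2) Lemma] -/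
theorem heckeThetaW_heckeCoord_add_nsmul (p : Finset {w : InfinitePlace K // IsReal w})
    (I : FractionalIdeal (𝓞 K)⁰ K) (a₀ : K) {N : ℕ} (hN : Even N)
    (hV : ∀ i, (((fundSystem K i : (𝓞 K)ˣ) : K) ^ N - 1) * a₀ ∈ I) (q : Fin (rank K) → ℤ)
    (c : Fin (rank K) → ℝ) (t : ℝ) :
    heckeThetaW K p I a₀ (heckeCoord K (c + fun i ↦ ((N • q) i : ℝ)) t) =
      heckeThetaW K p I a₀ (heckeCoord K c t) := by
  set u : (𝓞 K)ˣ := fundUnit K (N • q) with hu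
  have hus : u ∈ cosetStabilizer I a₀ := fundUnit_nsmul_mem_cosetStabilizer hV q
  have hus' : u⁻¹ ∈ cosetStabilizer I a₀ := Subgroup.inv_mem _ hus
  -- the permutation `a ↦ u (a + a₀) - a₀` of `𝔞`
  have hmem : ∀ (v : (𝓞 K)ˣ), v ∈ cosetStabilizer I a₀ → ∀ a : {x : K // x ∈ I},
      ((v : 𝓞 K) : K) * ((a : K) + a₀) - a₀ ∈ I := by
    intro v hv a
    exact unit_mul_sub_mem hv (x := (a : K) + a₀) (by simp)
  have h1 : (((u⁻¹ : (𝓞 K)ˣ) : 𝓞 K) : K) * ((u : 𝓞 K) : K) = 1 := by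
    exact_mod_cast (show ((((u⁻¹ : (𝓞 K)ˣ) : 𝓞 K) * (u : 𝓞 K) : 𝓞 K) : K) = 1 by rw [Units.inv_mul]; rfl)
  have h2 : ((u : 𝓞 K) : K) * (((u⁻¹ : (𝓞 K)ˣ) : 𝓞 K) : K) = 1 := by rw [mul_comm]; exact h1
  let e : {x : K // x ∈ I} ≃ {x : K // x ∈ I} :=
    { toFun := fun a ↦ ⟨((u : 𝓞 K) : K) * ((a : K) + a₀) - a₀, hmem u hus a⟩
      invFun := fun a ↦ ⟨(((u⁻¹ : (𝓞 K)ˣ) : 𝓞 K) : K) * ((a : K) + a₀) - a₀, hmem u⁻¹ hus' a⟩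
      left_inv := fun a ↦ Subtype.ext (by
        simp only [sub_add_cancel]
        linear_combination ((a : K) + a₀) * h1)
      right_inv := fun a ↦ Subtype.ext (by
        simp only [sub_add_cancel]
        linear_combination ((a : K) + a₀) * h2) }
  set F : {x : K // x ∈ I} → ℂ := fun a ↦ ((realPow K p ((a : K) + a₀) * (∏ w ∈ p, Real.sqrt (heckeCoord K c t w.1)) *
    thetaSummand K (heckeCoord K c t) ((a : K) + a₀) : ℝ) : ℂ) with hF
  rw [heckeThetaW, heckeThetaW]
  calc _ = ∑' a : {x : K // x ∈ I}, F (e a) := tsum_congr fun a ↦ by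
          rw [heckeTerm_heckeCoord_add_nsmul p hN q c t, hF]
          simp [e, hu]
    _ = ∑' a : {x : K // x ∈ I}, F a := e.tsum_eq F

/-! ## The reflection `c ↦ 1 - c`: `f(-N) = f(N)` -/

/-- **`f(-N) = f(N)`**: reflecting the cube, `∫_{[0,1]^{r-1}} Θ̃(y(-Nc,t)) dc = ∫ Θ̃(y(Nc - N𝟙, t)) dc`,
and `N𝟙 ∈ Nℤ^{r-1}` is a period (Neukirch VII (8.4): the passage `F ↦ F⁻¹` between fundamental
domains). [cite: NeukirchANT1999, Ch. VII §8 (8.4) Proposition] -/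
theorem heckeFW_neg_natCast (p : Finset {w : InfinitePlace K // IsReal w}) (I : FractionalIdeal (𝓞 K)⁰ K)
    (a₀ : K) {N : ℕ} (hN : Even N) (hV : ∀ i, (((fundSystem K i : (𝓞 K)ˣ) : K) ^ N - 1) * a₀ ∈ I) (t : ℝ) :
    heckeFW K p I a₀ (-(N : ℝ)) t = heckeFW K p I a₀ N t := by
  rw [heckeFW, heckeFW, ← integral_indicator measurableSet_Icc, ← integral_indicator measurableSet_Icc,
    ← integral_sub_left_eq_self _ volume (1 : Fin (rank K) → ℝ)]
  refine integral_congr_ae (Filter.Eventually.of_forall fun c ↦ ?_)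
  change (Set.Icc (0 : Fin (rank K) → ℝ) 1).indicator
      (fun c ↦ heckeThetaW K p I a₀ (heckeCoord K ((-(N : ℝ)) • c) t)) (1 - c) = _
  have hmem : (1 - c ∈ Set.Icc (0 : Fin (rank K) → ℝ) 1) ↔ c ∈ Set.Icc (0 : Fin (rank K) → ℝ) 1 := by
    simp only [Set.mem_Icc, Pi.le_def, Pi.sub_apply, Pi.one_apply, Pi.zero_apply]
    constructor
    · rintro ⟨h1, h2⟩; exact ⟨fun i ↦ by linarith [h2 i], fun i ↦ by linarith [h1 i]⟩
    · rintro ⟨h1, h2⟩; exact ⟨fun i ↦ by linarith [h2 i], fun i ↦ by linarith [h1 i]⟩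
  by_cases hc : c ∈ Set.Icc (0 : Fin (rank K) → ℝ) 1
  · rw [Set.indicator_of_mem (hmem.mpr hc), Set.indicator_of_mem hc]
    have : (-(N : ℝ)) • (1 - c) = (N : ℝ) • c + fun i ↦ ((N • fun _ : Fin (rank K) ↦ (-1 : ℤ)) i : ℝ) := by
      funext i; simp; ring
    rw [this, heckeThetaW_heckeCoord_add_nsmul p I a₀ hN hV]
  · rw [Set.indicator_of_notMem (fun h ↦ hc (hmem.mp h)), Set.indicator_of_notMem hc]

/-! ## Coset decomposition of the dual theta series -/

/-- **Coset decomposition of `Θ̂̃`.**  Let `𝔠 ≤ 𝔟` be nonzero fractional ideals, `a₀ ∈ K` with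
`Tr(a₀ x) ∈ ℤ` for all `x ∈ 𝔠`, and `c_i` (`i ∈ ι`, finite) representatives of `𝔟/𝔠` (every `b ∈ 𝔟` is
`≡ c_i mod 𝔠` for exactly one `i`).  Then
`Θ̂̃^p_{𝔟,a₀}(y) = Σ_i e^{2πi Tr(a₀ c_i)} Θ̃^p_{𝔠,c_i}(y)` — the character `e^{2πi Tr(a₀ ·)}` is constant
on the cosets `c_i + 𝔠` (Neukirch VII (7.6), on the dual side). [cite: NeukirchANT1999, Ch. VII §7 (7.6) Lemma] -/
theorem heckeThetaDualW_eq_sum (p : Finset {w : InfinitePlace K // IsReal w}) {B C : FractionalIdeal (𝓞 K)⁰ K}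
    (hCB : C ≤ B) (a₀ : K) (hint : ∀ x ∈ C, ∃ n : ℤ, (n : ℚ) = Algebra.trace ℚ K (a₀ * x))
    {ι : Type*} [Fintype ι] (c : ι → K) (hc : ∀ i, c i ∈ B) (hcov : ∀ b ∈ B, ∃! i, b - c i ∈ C)
    {y : InfinitePlace K → ℝ} (hy : ∀ w, 0 < y w) :
    heckeThetaDualW K p B a₀ y =
      ∑ i, (𝐞 (((Algebra.trace ℚ K (a₀ * c i) : ℚ) : ℝ)) : ℂ) * heckeThetaW K p C (c i) y := by
  -- the bijection `(i, x) ↦ c_i + x : ι × 𝔠 ≃ 𝔟`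
  have haddmem : ∀ (i : ι) {x : K}, x ∈ C → c i + x ∈ B := fun i x hx ↦ B.val.add_mem (hc i) (hCB hx)
  have hinj : ∀ {i j : ι} {x x' : K}, x ∈ C → x' ∈ C → c i + x = c j + x' → i = j := by
    intro i j x x' hx hx' h
    obtain ⟨k, -, hk⟩ := hcov _ (haddmem i hx)
    have h1 : i = k := hk i (by simpa using hx)
    have h2 : j = k := hk j (by rw [h]; simpa using hx')
    rw [h1, h2]
  let e : ι × {x : K // x ∈ C} ≃ {x : K // x ∈ B} :=
    { toFun := fun z ↦ ⟨c z.1 + (z.2 : K), haddmem z.1 z.2.2⟩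
      invFun := fun b ↦ ⟨(hcov b b.2).choose, ⟨(b : K) - c (hcov b b.2).choose, (hcov b b.2).choose_spec.1⟩⟩
      left_inv := fun z ↦ by
        obtain ⟨i, x⟩ := z
        have hb : c i + (x : K) ∈ B := haddmem i x.2
        have hi : i = (hcov _ hb).choose := (hcov _ hb).choose_spec.2 i (by simp)
        refine Prod.ext hi.symm (Subtype.ext ?_)
        change c i + (x : K) - c (hcov _ hb).choose = x
        rw [← hi]; ring
      right_inv := fun b ↦ Subtype.ext (by simp) }
  -- summability and the rearrangement
  set F : {x : K // x ∈ B} → ℂ := fun b ↦ (𝐞 (((Algebra.trace ℚ K (a₀ * (b : K)) : ℚ) : ℝ)) : ℂ) *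
      ((realPow K p (b : K) * (∏ w ∈ p, Real.sqrt (y w.1)) * thetaSummand K y (b : K) : ℝ) : ℂ) with hF
  have hsum : Summable F := summable_heckeDualTerm p B a₀ hy
  set G : ι × {x : K // x ∈ C} → ℂ := fun z ↦ F (e z) with hG
  have hsum' : Summable G := e.summable_iff.mpr hsum
  rw [heckeThetaDualW, ← e.tsum_eq]
  change ∑' z, G z = _
  rw [hsum'.tsum_prod' (fun i ↦ hsum'.comp_injective (Prod.mk_right_injective i)), tsum_fintype]
  refine Finset.sum_congr rfl fun i _ ↦ ?_
  rw [heckeThetaW, ← tsum_mul_left]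
  refine tsum_congr fun x ↦ ?_
  change (𝐞 (((Algebra.trace ℚ K (a₀ * (c i + (x : K))) : ℚ) : ℝ)) : ℂ) *
      ((realPow K p (c i + (x : K)) * (∏ w ∈ p, Real.sqrt (y w.1)) * thetaSummand K y (c i + (x : K)) : ℝ) : ℂ) = _
  obtain ⟨n, hn⟩ := hint x x.2
  rw [mul_add, map_add, ← hn, Rat.cast_add, Rat.cast_intCast, AddChar.map_add_eq_mul, Circle.coe_mul,
    Real.fourierChar_apply' (n : ℝ), Circle.exp_two_pi_mul_int, Circle.coe_one, mul_one, add_comm (c i)]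

/-- **Coset decomposition of the cube integral `g`**: `g_{𝔟,a₀}(β, t) = Σ_i e^{2πi Tr(a₀c_i)} f_{𝔠,c_i}(β, t)`
(integral of the finite sum `heckeThetaDualW_eq_sum` over the cube). [cite: NeukirchANT1999, Ch. VII §7 (7.6) Lemma] -/
theorem heckeGW_eq_sum (p : Finset {w : InfinitePlace K // IsReal w}) {B C : FractionalIdeal (𝓞 K)⁰ K}
    (hCB : C ≤ B) (a₀ : K) (hint : ∀ x ∈ C, ∃ n : ℤ, (n : ℚ) = Algebra.trace ℚ K (a₀ * x))
    {ι : Type*} [Fintype ι] (c : ι → K) (hc : ∀ i, c i ∈ B) (hcov : ∀ b ∈ B, ∃! i, b - c i ∈ C)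
    (β t : ℝ) :
    heckeGW K p B a₀ β t =
      ∑ i, (𝐞 (((Algebra.trace ℚ K (a₀ * c i) : ℚ) : ℝ)) : ℂ) * heckeFW K p C (c i) β t := by
  rw [heckeGW]
  simp_rw [heckeFW, ← integral_const_mul]
  rw [← integral_finsetSum _ fun i _ ↦ (Continuous.const_mul
    (continuous_heckeThetaW_heckeCoord p C (c i) β t) _).continuousOn.integrableOn_compact isCompact_Icc]
  exact setIntegral_congr_fun measurableSet_Icc fun x _ ↦
    heckeThetaDualW_eq_sum p hCB a₀ hint c hc hcov fun w ↦ heckeCoord_pos _ _ w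

/-- The constant terms match: `𝟙[p = ∅] = Σ_i e^{2πi Tr(a₀c_i)} 𝟙[p = ∅ ∧ c_i ∈ 𝔠]` (exactly one
representative, that of the zero class, lies in `𝔠`, and there the character is `1`). [folklore] -/
theorem sum_fourierChar_mul_heckeThetaConst (p : Finset {w : InfinitePlace K // IsReal w})
    {B C : FractionalIdeal (𝓞 K)⁰ K} (a₀ : K) (hint : ∀ x ∈ C, ∃ n : ℤ, (n : ℚ) = Algebra.trace ℚ K (a₀ * x))
    {ι : Type*} [Fintype ι] (c : ι → K) (hcov : ∀ b ∈ B, ∃! i, b - c i ∈ C) :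
    ∑ i, (𝐞 (((Algebra.trace ℚ K (a₀ * c i) : ℚ) : ℝ)) : ℂ) * heckeThetaConst K p C (c i) =
      if p = ∅ then 1 else 0 := by
  obtain ⟨i₀, hi₀, huniq⟩ := hcov 0 (FractionalIdeal.zero_mem B)
  have hi₀' : c i₀ ∈ C := by simpa using C.val.neg_mem hi₀
  have hothers : ∀ i, i ≠ i₀ → c i ∉ C := fun i hi hci ↦ hi (huniq i (by
    change 0 - c i ∈ C
    rw [zero_sub]; exact C.val.neg_mem hci))
  rw [Finset.sum_eq_single i₀ (fun i _ hi ↦ ?_) (fun h ↦ (h (Finset.mem_univ _)).elim)]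
  · obtain ⟨n, hn⟩ := hint _ hi₀'
    rw [heckeThetaConst, ← hn, Rat.cast_intCast, Real.fourierChar_apply' (n : ℝ), Circle.exp_two_pi_mul_int,
      Circle.coe_one, one_mul]
    simp [hi₀']
  · rw [heckeThetaConst, if_neg (fun h ↦ hothers i hi h.2), mul_zero]

/-- **The Mellin transform of the dual side.**  Let `P = heckePairW K p 𝔞 a₀ N` (`N` even), `𝔟 = (𝔞𝔡)⁻¹`
its dual ideal, `𝔠 ≤ 𝔟` nonzero with `Tr(a₀𝔠) ⊆ ℤ`, `c_i` representatives of `𝔟/𝔠` whose cosets are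
`V = ⟨u_i^N⟩`-stable, and `P_i = heckePairW K p 𝔠 c_i N`.  Then for `re s > 1/2`,
`Λ_{P^symm}(s) = Σ_i e^{2πi Tr(a₀c_i)} Λ_{P_i}(s)`: the Mellin transform of `g - g₀` (Mathlib
`WeakFEPair.hasMellin` for `P^symm`) is the character combination of the Mellin transforms of the
`f_i - f_{i,0}` (`heckeGW_eq_sum`, `heckeFW_neg_natCast`, `sum_fourierChar_mul_heckeThetaConst`).  This
is the dual half of Neukirch VII (8.3) ("`Λ(𝔎',χ̄,1-s) = L(g, …)`"), before the identification of the
character combination with a Gauss sum. [cite: NeukirchANT1999, Ch. VII §8 (8.3)–(8.5)] -/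
theorem heckePairW_symm_Λ_eq_sum (p : Finset {w : InfinitePlace K // IsReal w})
    (I : (FractionalIdeal (𝓞 K)⁰ K)ˣ) (a₀ : K) {N : ℕ} (hN : Even N)
    (C : (FractionalIdeal (𝓞 K)⁰ K)ˣ)
    (hCB : (C : FractionalIdeal (𝓞 K)⁰ K) ≤ FractionalIdeal.dual ℤ ℚ (I : FractionalIdeal (𝓞 K)⁰ K))
    (hint : ∀ x ∈ (C : FractionalIdeal (𝓞 K)⁰ K), ∃ n : ℤ, (n : ℚ) = Algebra.trace ℚ K (a₀ * x))
    {ι : Type*} [Fintype ι] (c : ι → K) (hc : ∀ i, c i ∈ FractionalIdeal.dual ℤ ℚ (I : FractionalIdeal (𝓞 K)⁰ K))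
    (hcov : ∀ b ∈ FractionalIdeal.dual ℤ ℚ (I : FractionalIdeal (𝓞 K)⁰ K), ∃! i, b - c i ∈ (C : FractionalIdeal (𝓞 K)⁰ K))
    (hV : ∀ j i, (((fundSystem K i : (𝓞 K)ˣ) : K) ^ N - 1) * c j ∈ (C : FractionalIdeal (𝓞 K)⁰ K))
    {s : ℂ} (hs : 1 / 2 < s.re) :
    (heckePairW K p I a₀ N).symm.Λ s =
      ∑ i, (𝐞 (((Algebra.trace ℚ K (a₀ * c i) : ℚ) : ℝ)) : ℂ) * (heckePairW K p C (c i) N).Λ s := by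
  set P := heckePairW K p I a₀ N with hP
  set Q : ι → WeakFEPair ℂ := fun i ↦ heckePairW K p C (c i) N with hQ
  set e : ι → ℂ := fun i ↦ (𝐞 (((Algebra.trace ℚ K (a₀ * c i) : ℚ) : ℝ)) : ℂ) with he
  -- `g - g₀ = Σ_i e_i (f_i - f_{i,0})` on `t > 0`
  have hfun : ∀ t : ℝ, 0 < t → P.symm.f t - P.symm.f₀ = ∑ i, e i * ((Q i).f t - (Q i).f₀) := by
    intro t ht
    change heckeGW K p (FractionalIdeal.dual ℤ ℚ (I : FractionalIdeal (𝓞 K)⁰ K)) a₀ (-(N : ℝ)) t -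
      (if p = ∅ then 1 else 0) = ∑ i, e i * (heckeFW K p C (c i) N t - heckeThetaConst K p C (c i))
    rw [heckeGW_eq_sum p hCB a₀ hint c hc hcov, ← sum_fourierChar_mul_heckeThetaConst p a₀ hint c hcov,
      ← Finset.sum_sub_distrib]
    refine Finset.sum_congr rfl fun i _ ↦ ?_
    rw [heckeFW_neg_natCast p _ (c i) hN (hV i), mul_sub]
  -- Mellin transforms
  have hPk : P.symm.k = 1 / 2 := rfl
  have hsP : P.symm.k < s.re := by rw [hPk]; exact hs
  have hMP := P.symm.hasMellin hsP
  have hMQ : ∀ i, HasMellin (fun t ↦ (Q i).f t - (Q i).f₀) s ((Q i).Λ s) := fun i ↦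
    (Q i).hasMellin (by change (1 / 2 : ℝ) < s.re; exact hs)
  rw [← hMP.2]
  have hcongr : mellin (fun t ↦ P.symm.f t - P.symm.f₀) s =
      mellin (fun t ↦ ∑ i, e i * ((Q i).f t - (Q i).f₀)) s :=
    setIntegral_congr_fun measurableSet_Ioi fun t ht ↦ by
      change (t : ℂ) ^ (s - 1) • (P.symm.f t - P.symm.f₀) = (t : ℂ) ^ (s - 1) • ∑ i, e i * ((Q i).f t - (Q i).f₀)
      rw [hfun t ht]
  rw [hcongr, mellin]
  simp_rw [smul_eq_mul, Finset.mul_sum]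
  rw [integral_finsetSum _ fun i _ ↦ ?_]
  · refine Finset.sum_congr rfl fun i _ ↦ ?_
    rw [← (hMQ i).2, mellin, ← integral_const_mul]
    refine setIntegral_congr_fun measurableSet_Ioi fun t _ ↦ ?_
    rw [smul_eq_mul]; ring
  · have h := ((hMQ i).1.const_mul (e i))
    refine (integrableOn_congr_fun (fun t _ ↦ ?_) measurableSet_Ioi).mp h
    simp only [smul_eq_mul]; ring

/-- **The Mellin transform of the dual side, unfolded** (`re s > 1`):
`Λ_{P^symm}(s/2) = c_N A_p(s/2) Σ_i e^{2πi Tr(a₀c_i)} D_p[c_i + 𝔠](s)` with the signed coset series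
`D_p` of `HeckeThetaContinuation.lean` (tree `heckePairW_Λ_eq_signedCosetSum` for each `P_i`).
[cite: NeukirchANT1999, Ch. VII §8 (8.3)–(8.5)] -/
theorem heckePairW_symm_Λ_eq_sum_signedCosetSum (p : Finset {w : InfinitePlace K // IsReal w})
    (I : (FractionalIdeal (𝓞 K)⁰ K)ˣ) (a₀ : K) {N : ℕ} (hN0 : N ≠ 0) (hN : Even N)
    (C : (FractionalIdeal (𝓞 K)⁰ K)ˣ)
    (hCB : (C : FractionalIdeal (𝓞 K)⁰ K) ≤ FractionalIdeal.dual ℤ ℚ (I : FractionalIdeal (𝓞 K)⁰ K))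
    (hint : ∀ x ∈ (C : FractionalIdeal (𝓞 K)⁰ K), ∃ n : ℤ, (n : ℚ) = Algebra.trace ℚ K (a₀ * x))
    {ι : Type*} [Fintype ι] (c : ι → K) (hc : ∀ i, c i ∈ FractionalIdeal.dual ℤ ℚ (I : FractionalIdeal (𝓞 K)⁰ K))
    (hcov : ∀ b ∈ FractionalIdeal.dual ℤ ℚ (I : FractionalIdeal (𝓞 K)⁰ K), ∃! i, b - c i ∈ (C : FractionalIdeal (𝓞 K)⁰ K))
    (hV : ∀ j i, (((fundSystem K i : (𝓞 K)ˣ) : K) ^ N - 1) * c j ∈ (C : FractionalIdeal (𝓞 K)⁰ K))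
    {s : ℂ} (hs : 1 < s.re) :
    (heckePairW K p I a₀ N).symm.Λ (s / 2) =
      ((pieceCst K N : ℝ) : ℂ) * gammaFactorCP K p (s / 2) *
        ∑ i, (𝐞 (((Algebra.trace ℚ K (a₀ * c i) : ℚ) : ℝ)) : ℂ) *
          signedCosetSum K p (C : FractionalIdeal (𝓞 K)⁰ K) (c i) N s := by
  have hs' : 1 / 2 < (s / 2).re := by simp only [Complex.div_ofNat_re]; linarith
  rw [heckePairW_symm_Λ_eq_sum p I a₀ hN C hCB hint c hc hcov hV hs', Finset.mul_sum]
  refine Finset.sum_congr rfl fun i _ ↦ ?_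
  rw [heckePairW_Λ_eq_signedCosetSum p C (c i) hN0 hN (hV i) hs]
  ring

end NumberField

end Literature.NumberTheory.LFunctions
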